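import Summits.RiemannHypothesis.RiemannHypothesis.Theorems.LiAsymptoticDefs
import Summits.RiemannHypothesis.RiemannHypothesis.Theorems.LiCoefficientsLiWindowTuring
import Summits.RiemannHypothesis.RiemannHypothesis.Theorems.LiAsymptoticSmoothReplace
import HarnessLib

/-!
# RiemannHypothesis / LiAsymptotic — crux K3 `LiOscillatoryS`, stub K3a: the `S`-terms, PLAIN regime (RH-FREE)

RH-FREE [rh-li-prover].  Route `Theses/LiAsymptotic.lean` (rung L-P(P1⁺) «Li asymptotic law, quadratic range»,
cell `pub/rh-li`, theory memo `theory/TARGETS.md` §11.2 STEP 7), item `LiOscillatoryS` (stmt-RiemannHypothesis-19164),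
registered birth stub `stub_plain` (K3a) VERBATIM: for `n ≥ 900`, `T' ≥ n²`, with `a = √n`, `S = zetaArgS`,
`f_n = liWindowWeight n`, `f_n' = liWindowWeightDeriv n`,

  `|2 (S(T') f_n(T') − S(a) f_n(a) − ∫_a^{T'} S f_n')| ≤ liErrOscPlain n = 0.3083 √n log n + 7.1 √n + 0.62 log n + 13`.

Inputs (all tree theorems about the zeros of `ζ`, no hypothesis on their position): Backlund–Trudgian
`|S(t)| ≤ 0.3083 log t + 3.24` (`t ≥ 30`, `abs_zetaArgS_le_explicit`), `0 ≤ f_n ≤ 2`, `f_n(T') ≤ n²/(2T'²)`,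
`|f_n'| ≤ n/t²` (`Window.abs_liWindowWeightDeriv_le`); the integral is bounded by
`n ∫_a^∞ (0.3083 log t + 3.24)/t² = √n (0.15415 log n + 3.5483)`.  Nothing here bears on the truth of RH.
-/

noncomputable section

-- D-0017: `Summit.<S>.<S>.…` is the designed namespace of a single-problem summit.
set_option linter.dupNamespace false

open MeasureTheory intervalIntegral Set
open scoped Real Interval

namespace Summit.RiemannHypothesis.RiemannHypothesis.Theorems.LiTheory

open Literature.NumberTheory.LFunctions Literature.NumberTheory.LFunctions.SchoenfeldBound Window SmoothReplace

namespace Oscillatory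

/-! ### Sizes at `a = √n` and at `T' ≥ n²` -/

/-- Basic sizes: for `n ≥ 900`, `T' ≥ n²`: `a = √n ≥ 30`, `a² = n`, `a ≤ T'`, `log a = (log n)/2`. -/
theorem sizes {n : ℕ} {T' : ℝ} (hn : 900 ≤ n) (hT' : (n : ℝ) ^ 2 ≤ T') :
    30 ≤ Real.sqrt n ∧ Real.sqrt n ^ 2 = n ∧ Real.sqrt n ≤ T' ∧ Real.log (Real.sqrt n) = Real.log n / 2 ∧
      (n : ℝ) ^ 2 ≤ T' ∧ (900 : ℝ) ≤ n := by
  have hnR : (900 : ℝ) ≤ n := by exact_mod_cast hn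
  have hn0 : (0 : ℝ) ≤ n := by positivity
  have h30 : 30 ≤ Real.sqrt n := by
    have h : Real.sqrt ((30 : ℝ) ^ 2) = 30 := Real.sqrt_sq (by norm_num)
    rw [← h]; exact Real.sqrt_le_sqrt (by linarith)
  have hsq : Real.sqrt n ^ 2 = n := Real.sq_sqrt hn0
  refine ⟨h30, hsq, ?_, Real.log_sqrt hn0, hT', hnR⟩
  nlinarith

/-- The TOP boundary term is negligible: for `n ≥ 900`, `T' ≥ n²`, `|S(T')| f_n(T') ≤ 0.0005`
(`f_n(T') ≤ n²/(2T'²) ≤ 1/(2T')`, `log T' ≤ 2√T'`, `√T' ≥ n ≥ 900`). -/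
theorem top_term_le {n : ℕ} {T' : ℝ} (hn : 900 ≤ n) (hT' : (n : ℝ) ^ 2 ≤ T') :
    |zetaArgS T'| * liWindowWeight n T' ≤ 0.0005 := by
  obtain ⟨-, -, -, -, -, hnR⟩ := sizes hn hT'
  have hT0 : 0 < T' := by nlinarith
  have hT30 : 30 ≤ T' := by nlinarith
  have hS := abs_zetaArgS_le_explicit hT30
  have hf := liWindowWeight_le_sq n hT0
  have hf0 : 0 ≤ liWindowWeight n T' := by
    unfold liWindowWeight; linarith [Real.cos_le_one (n * liZeroAngle T')]
  -- `log T' ≤ 2 √T'` and `√T' ≥ n`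
  set r := Real.sqrt T' with hr
  have hrr : r ^ 2 = T' := Real.sq_sqrt hT0.le
  have hrn : (n : ℝ) ≤ r := by
    rw [hr, ← Real.sqrt_sq (n.cast_nonneg : (0 : ℝ) ≤ n)]; exact Real.sqrt_le_sqrt hT'
  have hr0 : 0 < r := by linarith
  have hlogT : Real.log T' ≤ 2 * r := by
    have h := Real.log_le_sub_one_of_pos hr0
    rw [hr, Real.log_sqrt hT0.le] at h
    rw [hr]; linarith
  have hlog0 : 0 ≤ Real.log T' := Real.log_nonneg (by linarith)
  -- `|S| f ≤ (0.3083 log T' + 3.24) n²/(2T'²)` and `n² ≤ T' = r²`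
  have h1 : |zetaArgS T'| * liWindowWeight n T' ≤ (0.3083 * Real.log T' + 3.24) * ((n : ℝ) ^ 2 / (2 * T' ^ 2)) :=
    mul_le_mul hS hf hf0 (by positivity)
  have hA : 0.3083 * Real.log T' + 3.24 ≤ 0.6166 * r + 3.24 := by linarith
  have hn2 : (n : ℝ) ^ 2 ≤ T' := by rw [← hrr]; nlinarith
  have hB : (n : ℝ) ^ 2 / (2 * T' ^ 2) ≤ 1 / (2 * r ^ 2) := by
    rw [div_le_div_iff₀ (by positivity) (by positivity), ← hrr]
    nlinarith [pow_pos hr0 2]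
  have hr900 : (900 : ℝ) ≤ r := hnR.trans hrn
  calc |zetaArgS T'| * liWindowWeight n T' ≤ (0.3083 * Real.log T' + 3.24) * ((n : ℝ) ^ 2 / (2 * T' ^ 2)) := h1
    _ ≤ (0.6166 * r + 3.24) * (1 / (2 * r ^ 2)) := mul_le_mul hA hB (by positivity) (by positivity)
    _ ≤ 0.0005 := by
        rw [← mul_div_assoc, mul_one, div_le_iff₀ (by positivity)]
        nlinarith

/-- The BOTTOM boundary term: `|S(a)| f_n(a) ≤ 2 (0.3083 log a + 3.24)` for `a ≥ 30`. -/
theorem bottom_term_le (n : ℕ) {a : ℝ} (ha : 30 ≤ a) :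
    |zetaArgS a| * liWindowWeight n a ≤ 2 * (0.3083 * Real.log a + 3.24) := by
  have hS := abs_zetaArgS_le_explicit ha
  have hf0 : 0 ≤ liWindowWeight n a := by
    unfold liWindowWeight; linarith [Real.cos_le_one (n * liZeroAngle a)]
  have hf2 : liWindowWeight n a ≤ 2 := by
    unfold liWindowWeight; linarith [Real.neg_one_le_cos (n * liZeroAngle a)]
  have hlog : 0 ≤ Real.log a := Real.log_nonneg (by linarith)
  calc |zetaArgS a| * liWindowWeight n a ≤ (0.3083 * Real.log a + 3.24) * 2 :=
        mul_le_mul hS hf2 hf0 (by positivity)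
    _ = 2 * (0.3083 * Real.log a + 3.24) := by ring

/-- The Backlund integral: `|∫_a^b S f_n'| ≤ n (0.3083 (log a + 1) + 3.24)/a` for `30 ≤ a ≤ b`. -/
theorem abs_integral_S_mul_deriv_le (n : ℕ) {a b : ℝ} (ha : 30 ≤ a) (hab : a ≤ b) :
    |∫ t in a..b, zetaArgS t * liWindowWeightDeriv n t| ≤ n * (0.3083 * (Real.log a + 1) + 3.24) / a := by
  have ha0 : 0 < a := by linarith
  have hn : (0 : ℝ) ≤ n := n.cast_nonneg
  have hle : ∀ᵐ t ∂volume, t ∈ Ioc a b →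
      ‖zetaArgS t * liWindowWeightDeriv n t‖ ≤ (0.3083 * Real.log t + 3.24) * (n / t ^ 2) :=
    Filter.Eventually.of_forall fun t ht ↦ by
      have ht30 : 30 ≤ t := by linarith [ht.1]
      have ht0 : 0 < t := by linarith
      rw [Real.norm_eq_abs, abs_mul]
      exact mul_le_mul (abs_zetaArgS_le_explicit ht30) (abs_liWindowWeightDeriv_le n ht0) (abs_nonneg _)
        (by have := Real.log_nonneg (by linarith : (1 : ℝ) ≤ t); positivity)
  have hcont : ContinuousOn (fun t : ℝ ↦ (0.3083 * Real.log t + 3.24) * (n / t ^ 2)) (uIcc a b) := by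
    refine continuousOn_of_forall_continuousAt fun t ht ↦ ?_
    rw [uIcc_of_le hab] at ht
    have ht0 : t ≠ 0 := by linarith [ht.1]
    have ht2 : t ^ 2 ≠ 0 := pow_ne_zero 2 ht0
    fun_prop (disch := assumption)
  have h := intervalIntegral.norm_integral_le_of_norm_le hab hle hcont.intervalIntegrable
  -- the antiderivative `−n (0.3083 (log t + 1) + 3.24)/t`
  have hFTC : ∫ t in a..b, (0.3083 * Real.log t + 3.24) * (n / t ^ 2) =
      n * (0.3083 * (Real.log a + 1) + 3.24) / a - n * (0.3083 * (Real.log b + 1) + 3.24) / b := by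
    have hderiv : ∀ t ∈ uIcc a b, HasDerivAt (fun y : ℝ ↦ -(n * (0.3083 * (Real.log y + 1) + 3.24) / y))
        ((0.3083 * Real.log t + 3.24) * (n / t ^ 2)) t := by
      intro t ht
      rw [uIcc_of_le hab] at ht
      have ht0 : t ≠ 0 := by linarith [ht.1]
      have h1 : HasDerivAt (fun y : ℝ ↦ (n : ℝ) * (0.3083 * (Real.log y + 1) + 3.24)) (n * (0.3083 * t⁻¹)) t := by
        have h := ((((Real.hasDerivAt_log ht0).add_const 1).const_mul (0.3083 : ℝ)).add_const (3.24 : ℝ)).const_mul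
          (n : ℝ)
        simpa using h
      have h := (h1.div (hasDerivAt_id t) ht0).neg
      refine h.congr_deriv ?_
      simp only [id]
      field_simp
      ring
    rw [intervalIntegral.integral_eq_sub_of_hasDerivAt hderiv hcont.intervalIntegrable]
    ring
  rw [hFTC, Real.norm_eq_abs] at h
  have hb0 : 0 < b := by linarith
  have hdrop : 0 ≤ n * (0.3083 * (Real.log b + 1) + 3.24) / b := by
    have := Real.log_nonneg (by linarith : (1 : ℝ) ≤ b); positivity
  linarith

end Oscillatory

open Oscillatory in
/-- **Stub K3a `stub_plain` of crux `LiOscillatoryS`** (route `LiAsymptotic`, stmt-RiemannHypothesis-19164; RH-FREE):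
for `n ≥ 900`, `T' ≥ n²`, `|2(S(T') f_n(T') − S(√n) f_n(√n) − ∫_{√n}^{T'} S f_n')| ≤ liErrOscPlain n`.  Verbatim the
registered signature `Sig.stub_plain`. -/
theorem liOscillatoryPlain_bound :
    ∀ (n : ℕ) (T' : ℝ), 900 ≤ n → (n : ℝ) ^ 2 ≤ T' →
      |2 * (zetaArgS T' * liWindowWeight n T' - zetaArgS (Real.sqrt n) * liWindowWeight n (Real.sqrt n) -
          ∫ t in Real.sqrt n..T', zetaArgS t * liWindowWeightDeriv n t)| ≤ liErrOscPlain n := by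
  intro n T' hn hT'
  obtain ⟨ha30, haa, haT, hloga, -, hnR⟩ := sizes hn hT'
  set a := Real.sqrt n with ha
  have ha0 : 0 < a := by linarith
  have h1 := top_term_le hn hT'
  have h2 := bottom_term_le n ha30
  have h3 := abs_integral_S_mul_deriv_le n ha30 haT
  rw [hloga] at h2 h3
  have h3' : (n : ℝ) * (0.3083 * (Real.log n / 2 + 1) + 3.24) / a = a * (0.15415 * Real.log n + 3.5483) := by
    rw [← haa]; field_simp; ring
  rw [h3'] at h3
  have hlogn : 0 ≤ Real.log n := Real.log_nonneg (by linarith)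
  -- triangle inequality
  have hf0T : 0 ≤ liWindowWeight n T' := (liWindowWeight_mem n T').1
  have hf0a : 0 ≤ liWindowWeight n a := (liWindowWeight_mem n a).1
  have hb1 : |zetaArgS T' * liWindowWeight n T'| ≤ 0.0005 := by
    rw [abs_mul, abs_of_nonneg hf0T]; exact h1
  have hb2 : |zetaArgS a * liWindowWeight n a| ≤ 2 * (0.3083 * (Real.log n / 2) + 3.24) := by
    rw [abs_mul, abs_of_nonneg hf0a]; exact h2
  have htri : ∀ x y z : ℝ, |2 * (x - y - z)| ≤ 2 * (|x| + |y| + |z|) := fun x y z ↦ by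
    rw [abs_mul, abs_two]
    refine mul_le_mul_of_nonneg_left ?_ (by norm_num)
    calc |x - y - z| ≤ |x - y| + |z| := abs_sub _ _
      _ ≤ |x| + |y| + |z| := by linarith [abs_sub x y]
  refine (htri _ _ _).trans ?_
  unfold liErrOscPlain
  rw [← ha]
  nlinarith [mul_nonneg ha0.le hlogn]

end Summit.RiemannHypothesis.RiemannHypothesis.Theorems.LiTheory

end
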